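import Summits.HodgeConjecture.HodgeConjecture.Theses.HeckePrymWeil
import Literature.AlgebraicGeometry.Motives.AbelianVarietyProduct
import Literature.AlgebraicGeometry.Motives.AbelianVarietyProductDimProofs
import Literature.AlgebraicGeometry.Motives.HyperbolicWeilType

/-!
# Skeleton line `real-quadratic-base-change` for crux `WeilSixfoldsSqrtMinus7` (stmt-HodgeConjecture-1260)

Route `HeckePrymWeil`, crux r2 `WeilSixfoldsSqrtMinus7` = "on every complex abelian SIXFOLD `A` with an
endomorphism `φ`, `φ ≫ φ = -7` (`K = ℚ(√-7) ↪ End⁰ A`), every rational `(3,3)`-class in the (complexified)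
Weil plane — typed as `Eig((𝟙+φ)^*, (1+i√7)⁶) ⊔ Eig((𝟙+φ)^*, (1-i√7)⁶) ⊆ H⁶(A(ℂ);ℂ)` — is algebraic"
(all discriminants `det H ∈ ℚ^×/Nm K^×`; known: the hyperbolic class `det H = -1`, Markman
arXiv:2502.03415; open otherwise, arXiv:2603.20268 §1).

## The line (crux idea `real-quadratic-base-change`, ideator r1 k1; triage r1: pass)

LEVER. Base change `A ↦ A ⊗_ℤ O_F = A × A` along a real quadratic field `F = ℚ(√t)`:
`ψ_K := φ × φ` (`ψ_K² = -7`) and `ψ_F := (x, y) ↦ (t·y, x)` (`ψ_F² = t`, commuting with `ψ_K`; proved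
below, `psiK_comp_psiK`, `psiF_comp_psiF`, `psiK_comm_psiF`) make `A × A` an abelian 12-fold
(`dim_bc`) with multiplication by the CM field `L = ℚ(√-7, √t)`, of `L`-Weil type `(3,3)` at all four
embeddings when `A` is of `K`-Weil type `(3,3)`; its `L`-Weil space `W_L = ∧⁶_L H¹ ⊆ H⁶(·, ℚ)`
(`dim_ℚ 4`) complexifies to the four JOINT eigen-lines of `(𝟙+ψ_K)^*`, `(𝟙+ψ_F)^*` (`lWeilSpan`).
Two facts make this a transfer of the crux:
* UNTWISTING (`stub_untwisting`): `ι^*`, `ι = (id, 0) : A → A × A`, maps `W_L(A × A)` ONTO `W_K(A)`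
  (the `(σ, ±√t)`-line is `∧⁶{p₁^*α ± √t·p₂^*α} = Σ_k (±√t)^k Ω_σ^{(6-k,k)}`, and `ι^*` keeps `k = 0`),
  so the `K`-Weil classes of `A` are algebraic as soon as the `L`-Weil classes of `A ⊗ O_F` are;
* SPLITTING (`stub_baseChangeSplitting`): for the `L`-symmetrised hyperplane class `h` of `A × A`
  (for a Segre-type embedding, `h ∝ [E_A ⊕ tE_A]`, `E_A = 7E₀ + φ^*E₀` van Geemen's `K`-compatible
  polarization) the relative hermitian form is `H_A ⊗_K L`: signatures `(3,3)` at both real places of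
  `F`, relative discriminant `-δ₀ ∈ F^×/Nm_{L/F} L^×` (`det H_A = -δ₀`, `δ₀ > 0`); so `A ⊗ O_F` is of
  SPLIT (relatively hyperbolic) `L`-Weil type — `H¹(A×A, ℚ)` contains an `L`-stable Lagrangian
  `ℚ`-subspace of dimension 12 (Markman arXiv:2509.23079 Lemma 8.3.4 (2) = Deligne–Milne; Landherr) —
  iff `δ₀ ∈ Nm_{L/F} L^×` iff `F` splits the quaternion algebra `(δ₀, -7)_ℚ`, which `F = ℚ(√δ₀)`
  always does. The discriminant obstruction of the crux DIES over `F`: every Weil-type `(A, φ)` lands,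
  for one `t` per `δ`, in the split component, the home of Markman's relative secant machine.
TARGET `C⁺(F)` (`stub_splitSecantClass`, HARDEST, open = Markman's programme at `(d, e, n) = (6, 4, 6)`),
stated for EVERY polarized abelian 12-fold `(B, ψ_K, ψ_F, h)` of split `L`-Weil type (strictly more
than the crux needs — exactly what the engine outputs): ONE non-zero rational `L`-Weil class of `B` is
algebraic (arXiv:2509.23079 Lemma 10.2.3: `(B, η, h) ≅ ((X_F × X̂_F, I), η, Ξ_{t'})`, `I ∈ Ω_{B,t'}`,
for any split anchor, `X_F` an abelian sixfold with real multiplication by `F`; Thm 1.1.2 + Prop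
1.1.1: a `B`-secant pair `F₁, F₂` on `X_F` gives `κ(Φ(F₁ ⊠ F₂^∨))` whose flat deformation stays Hodge
on the whole family and whose `HW`-projection is non-zero; if it stays ALGEBRAIC — equivariant
semiregularity of `E = Φ(F₁ ⊠ F₂^∨)`, done in print only for `e = 2`, genus 3 (arXiv:2502.03415
§1.5), "postponed" for `[K:ℚ] > 2` (2509.23079 §1.1) — every class of `HW` is algebraic).
`stub_oneClassSuffices` (Lieberman-type: `L` acts on the `L`-line `W_L` through pull-backs by
ISOGENIES in `ℤ[ψ_K, ψ_F]`, which preserve algebraic classes) turns one class into all.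
`WeilSixfoldsSqrtMinus7_of` composes the four stubs into the crux BY NAME (kernel-checked, no `sorry`;
`c = 0` is trivial, and `c ≠ 0` is the Weil-type witness `stub_baseChangeSplitting` consumes; the
product bookkeeping `ψ_K² = -7`, `ψ_F² = t`, `ψ_Kψ_F = ψ_Fψ_K`, `dim = 12` is PROVED here, not stubbed).

## Disproof used
`payload.disproof_path` (refuter-cdisprove-stmt-HodgeConjecture-1260-0/…/Disproof.lean) does not exist,
no `Disproof.lean` is published in `Cruxes/WeilSixfoldsSqrtMinus7/` (`ledger crux ls`, 2026-08-16) and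
no `Theorems/WeilSixfoldsSqrtMinus7/Negative/` lemma has landed: no `_false_without_` theorem to cite
or import. The two load-bearing hypotheses identified by the route reviews (rreview 9bee0ce5: dropping
`IsRationalClass` or `IsOfHodgeType (3,3)` makes the crux false) are honoured: rationality and Hodge
type `(3,3)` are hypotheses of `KWeilAlgebraic`/`LWeilAlgebraic` in every stub, and the Weil-type
witness (`c ≠ 0`) is what `stub_baseChangeSplitting` consumes. `ledger negatives --problem
HodgeConjecture` = 2 statements (stmt-12555: a 22×22 matrix identity; stmt-11121: Fermat Hodge
multisets) — no stub is an instance of either. The in-tree negative knowledge on SEMIREGULARITY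
carriers (`Theorems/SemiregularSeedsOnAnchors/Negative/SemiregularityCarrier`: ∃-decorated
semiregularity is vacuous, ∀-decorated refutable) is the reason the semiregularity step is NOT typed as
a stub over `AtiyahTraceAlgebra` but kept inside `stub_splitSecantClass`, stated on real carriers;
likewise positivity of the polarization is carried by a hyperplane class (`a ≠ 0` is essential:
`a = 0` would make `SplitFrame` isotropy vacuous and `stub_splitSecantClass` a costume of HC).
-/

noncomputable section

open CategoryTheory
open Literature.AlgebraicGeometry.Motives
open Literature.AlgebraicGeometry.HodgeTheory
open Literature.AlgebraicGeometry.Motives.AbelianVariety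

namespace Summit.HodgeConjecture.HodgeConjecture.Cruxes.WeilSixfoldsSqrtMinus7.RealQuadraticBaseChange

/-! ### Notation (transparent definitions over the tree's real carriers) -/

/-- The eigenspace of `(𝟙_B + ψ)^*` on `H⁶(B(ℂ); ℂ)` for the eigenvalue `μ` — the literal shape in which
the crux types the Weil plane (`ψ = φ`, `μ = (1 ± i√7)⁶`). -/
abbrev eig6 (B : AbelianVariety ℂ) (ψ : B ⟶ B) (μ : ℂ) : Submodule ℂ (complexBetti B.X 6) :=
  Module.End.eigenspace (complexBetti.map (𝟙 B + ψ).hom.hom.hom 6).hom μ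

/-- `(1 + i√7)⁶`, the eigenvalue of `(𝟙+ψ_K)^*` on `∧⁶ V_σ` (literally the crux's constant). -/
abbrev lamKp : ℂ := (1 + Complex.I * (Real.sqrt (7 : ℝ) : ℂ)) ^ 6

/-- `(1 - i√7)⁶`, the eigenvalue of `(𝟙+ψ_K)^*` on `∧⁶ V_σ̄` (literally the crux's constant). -/
abbrev lamKm : ℂ := (1 - Complex.I * (Real.sqrt (7 : ℝ) : ℂ)) ^ 6

/-- `(1 + √t)⁶`, the eigenvalue of `(𝟙+ψ_F)^*` on `∧⁶` of the `+√t`-eigenspace of `ψ_F^*`. -/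
abbrev lamFp (t : ℕ) : ℂ := (1 + (Real.sqrt (t : ℝ) : ℂ)) ^ 6

/-- `(1 - √t)⁶`, the eigenvalue of `(𝟙+ψ_F)^*` on `∧⁶` of the `-√t`-eigenspace of `ψ_F^*`. -/
abbrev lamFm (t : ℕ) : ℂ := (1 - (Real.sqrt (t : ℝ) : ℂ)) ^ 6

/-- The complexified `K`-Weil plane of `(A, φ)` in the crux's literal typing:
`Eig((𝟙+φ)^*, (1+i√7)⁶) ⊔ Eig((𝟙+φ)^*, (1-i√7)⁶) ⊆ H⁶(A(ℂ); ℂ)`. -/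
abbrev KWeilSpan (A : AbelianVariety ℂ) (φ : A ⟶ A) : Submodule ℂ (complexBetti A.X 6) :=
  Module.End.eigenspace (complexBetti.map (𝟙 A + φ).hom.hom.hom 6).hom
      ((1 + Complex.I * (Real.sqrt (7 : ℝ) : ℂ)) ^ 6) ⊔
    Module.End.eigenspace (complexBetti.map (𝟙 A + φ).hom.hom.hom 6).hom
      ((1 - Complex.I * (Real.sqrt (7 : ℝ) : ℂ)) ^ 6)

/-- "The `K`-Weil classes of `(A, φ)` are algebraic" — VERBATIM the body of the crux for a fixed `(A, φ)`
(checked by `Iff.rfl` at the end of the file): every rational `(3,3)`-class in `KWeilSpan A φ` lies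
in `algebraicClasses A.X 3`. -/
def KWeilAlgebraic (A : AbelianVariety ℂ) (φ : A ⟶ A) : Prop :=
  ∀ c : complexBetti A.X 6, IsRationalClass c → IsOfHodgeType 6 A.X 6 3 3 c →
    c ∈ Module.End.eigenspace (complexBetti.map (𝟙 A + φ).hom.hom.hom 6).hom
        ((1 + Complex.I * (Real.sqrt (7 : ℝ) : ℂ)) ^ 6) ⊔
      Module.End.eigenspace (complexBetti.map (𝟙 A + φ).hom.hom.hom 6).hom
        ((1 - Complex.I * (Real.sqrt (7 : ℝ) : ℂ)) ^ 6) →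
    c ∈ algebraicClasses A.X 3

/-- The complexified `L`-Weil space of a 12-fold `B` with commuting `ψ_K` (`ψ_K² = -7`) and `ψ_F`
(`ψ_F² = t`), `L = ℚ(√-7, √t)`: the join of the four JOINT eigenspaces
`Eig((𝟙+ψ_K)^*, (1 ± i√7)⁶) ⊓ Eig((𝟙+ψ_F)^*, (1 ± √t)⁶) ⊆ H⁶(B(ℂ); ℂ)` — for `t > 0` these are the
four lines `∧⁶ V_{(σ,±√t)}` and their sum is `(∧⁶_L H¹(B, ℚ)) ⊗ ℂ = HW(B, η) ⊗ ℂ`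
(Markman 2509.23079 §1.1; triage r1 check (d)). -/
abbrev lWeilSpan (B : AbelianVariety ℂ) (ψK ψF : B ⟶ B) (t : ℕ) : Submodule ℂ (complexBetti B.X 6) :=
  ((eig6 B ψK lamKp ⊓ eig6 B ψF (lamFp t)) ⊔ (eig6 B ψK lamKp ⊓ eig6 B ψF (lamFm t))) ⊔
    ((eig6 B ψK lamKm ⊓ eig6 B ψF (lamFp t)) ⊔ (eig6 B ψK lamKm ⊓ eig6 B ψF (lamFm t)))

/-- "The `L`-Weil classes of `(B, ψ_K, ψ_F)` are algebraic": every rational `(3,3)`-class of the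
12-fold `B` lying in `lWeilSpan B ψK ψF t` is in `algebraicClasses B.X 3`. -/
def LWeilAlgebraic (B : AbelianVariety ℂ) (ψK ψF : B ⟶ B) (t : ℕ) : Prop :=
  ∀ c : complexBetti B.X 6, IsRationalClass c → IsOfHodgeType 12 B.X 6 3 3 c →
    c ∈ lWeilSpan B ψK ψF t → c ∈ algebraicClasses B.X 3

/-- "ONE non-zero rational class of the `L`-Weil space of `(B, ψ_K, ψ_F)` is algebraic" — the shape in
which Markman's engine delivers (`κ_{d/2}(E)` projects to a non-zero class of `HW`, Prop 1.1.1). -/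
def OneLWeilClassAlgebraic (B : AbelianVariety ℂ) (ψK ψF : B ⟶ B) (t : ℕ) : Prop :=
  ∃ c₀ : complexBetti B.X 6, IsRationalClass c₀ ∧ c₀ ∈ lWeilSpan B ψK ψF t ∧ c₀ ≠ 0 ∧
    c₀ ∈ algebraicClasses B.X 3

/-- The `L`-symmetrised hyperplane class `h = (7 + ψ_K^*)(t + ψ_F^*) ι^* a` of `B`, `ι` a projective
embedding of `B`, `a ∈ H²(ℙᴺ(ℂ); ℂ)`: for `a = ±[H]` (i.e. `a` rational, `a ≠ 0`) this is `±` the class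
of an AMPLE, `L`-compatible polarization (`ψ_K^* h = 7h` since `[-7]^* = 49` on `H²`; `ψ_F^* h = t·h`
since `[t]^* = t²`; `ψ_K`, `ψ_F` are isogenies, so the averaging keeps ampleness; van Geemen's Lemma
5.2 (1) done twice) — positivity is carried honestly, up to a global sign which changes no isotropy
condition, instead of by an untyped "ample". -/
abbrev lSymmPolarizationClass (B : AbelianVariety ℂ) (ψK ψF : B ⟶ B) (t : ℕ)
    (e : ProjectiveEmbedding B.X) (a : complexBetti (projectiveSpace e.n ℂ) 2) : complexBetti B.X 2 :=
  (7 : ℂ) • ((t : ℂ) • complexBetti.map e.ι 2 a + complexBetti.map ψF.hom.hom.hom 2 (complexBetti.map e.ι 2 a)) +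
    complexBetti.map ψK.hom.hom.hom 2
      ((t : ℂ) • complexBetti.map e.ι 2 a + complexBetti.map ψF.hom.hom.hom 2 (complexBetti.map e.ι 2 a))

/-- **Split (relatively hyperbolic) `L`-Weil type**, on real carriers exactly as the tree's
`Motives.IsHyperbolicWeilType` renders hyperbolicity: `H¹(B(ℂ); ℂ)` contains 12 rational,
`ℂ`-independent classes spanning a subspace stable under `ψ_K^*` AND `ψ_F^*` (an `L`-subspace of
`L`-dimension 3 = half of `dim_L H¹ = 6`) and pairwise isotropic for the polarization pairing
`Q_h(x, y) = h¹¹ ⌣ x ⌣ y` of the `L`-symmetrised hyperplane class `h` — i.e. (Markman arXiv:2509.23079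
Lemma 8.3.4 (2), Def 8.3.5 = Deligne–Milne) the relative hermitian form of `(B, η, ±E_h)` has an
isotropic `L`-subspace of dimension `d/2 = 3`: the polarized triple is of SPLIT TYPE. -/
def SplitFrame (B : AbelianVariety ℂ) (ψK ψF : B ⟶ B) (t : ℕ) (e : ProjectiveEmbedding B.X)
    (a : complexBetti (projectiveSpace e.n ℂ) 2) : Prop :=
  ∃ u : Fin 12 → complexBetti B.X 1,
    (∀ i, IsRationalClass (u i)) ∧ LinearIndependent ℂ u ∧
      (∀ i, complexBetti.map ψK.hom.hom.hom 1 (u i) ∈ Submodule.span ℂ (Set.range u)) ∧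
      (∀ i, complexBetti.map ψF.hom.hom.hom 1 (u i) ∈ Submodule.span ℂ (Set.range u)) ∧
        ∀ i j, polarizationPairingOne B.X (lSymmPolarizationClass B ψK ψF t e a) 11 (u i) (u j) = 0

/-- The base change `A ⊗_ℤ O_F = A × A` (`F = ℚ(√t)`, coordinates in the basis `1, √t`). -/
abbrev bc (A : AbelianVariety ℂ) : AbelianVariety ℂ := A.prod A

/-- `ψ_K = φ × φ` on `A × A`. -/
abbrev psiK (A : AbelianVariety ℂ) (φ : A ⟶ A) : bc A ⟶ bc A :=
  prodLift (fst A A ≫ φ) (snd A A ≫ φ)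

/-- `ψ_F = √t ⊗ 1` on `A ⊗ O_F = A × A`: `(x, y) ↦ (t·y, x)`. -/
abbrev psiF (A : AbelianVariety ℂ) (t : ℕ) : bc A ⟶ bc A :=
  prodLift ((t : ℤ) • snd A A) (fst A A)

/-! ### Product bookkeeping (PROVED): `A ⊗ O_F` is a 12-fold with commuting `ψ_K² = -7`, `ψ_F² = t` -/

/-- `dim (A × A) = 12` for a sixfold `A` (`AbelianVariety.dim_prod`). -/
theorem dim_bc {A : AbelianVariety ℂ} (hA : A.dim = 6) : (bc A).dim = 12 := by
  rw [dim_prod]; omega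

/-- `ψ_K ≫ ψ_K = -7` on `A × A` (componentwise, `prod_hom_ext`). -/
theorem psiK_comp_psiK {A : AbelianVariety ℂ} {φ : A ⟶ A} (hφ : φ ≫ φ = -((7 : ℤ) • 𝟙 A)) :
    psiK A φ ≫ psiK A φ = -((7 : ℤ) • 𝟙 (bc A)) := by
  apply prod_hom_ext
  · rw [Category.assoc, prodLift_fst, ← Category.assoc, prodLift_fst, Category.assoc, hφ]
    simp [Preadditive.comp_neg, Preadditive.neg_comp]
  · rw [Category.assoc, prodLift_snd, ← Category.assoc, prodLift_snd, Category.assoc, hφ]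
    simp [Preadditive.comp_neg, Preadditive.neg_comp]

/-- `ψ_F ≫ ψ_F = t` on `A × A`: `(x, y) ↦ (t·y, x) ↦ (t·x, t·y)`. -/
theorem psiF_comp_psiF (A : AbelianVariety ℂ) (t : ℕ) :
    psiF A t ≫ psiF A t = (t : ℤ) • 𝟙 (bc A) := by
  apply prod_hom_ext
  · rw [Category.assoc, prodLift_fst, Preadditive.comp_zsmul, prodLift_snd, Preadditive.zsmul_comp,
      Category.id_comp]
  · rw [Category.assoc, prodLift_snd, prodLift_fst, Preadditive.zsmul_comp, Category.id_comp]

/-- `ψ_K ≫ ψ_F = ψ_F ≫ ψ_K` (`L = K·F` is commutative: `(φx, φy) ↦ (t·φy, φx) = ψ_K(t·y, x)`). -/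
theorem psiK_comm_psiF (A : AbelianVariety ℂ) (φ : A ⟶ A) (t : ℕ) :
    psiK A φ ≫ psiF A t = psiF A t ≫ psiK A φ := by
  apply prod_hom_ext
  · rw [Category.assoc, prodLift_fst, Preadditive.comp_zsmul, prodLift_snd, Category.assoc,
      prodLift_fst, ← Category.assoc, prodLift_fst, Preadditive.zsmul_comp]
  · rw [Category.assoc, prodLift_snd, prodLift_fst, Category.assoc, prodLift_snd, ← Category.assoc,
      prodLift_snd]

/-! ### The four stub STATEMENTS (named `Prop`s; the registered `stub_*` theorems below restate them
verbatim, and `Registered.stub_*` are their name-keyed aliases used as the hypotheses of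
`WeilSixfoldsSqrtMinus7_of` — the native skeleton audit admits hypotheses BY NAME) -/

/-- STUB 1 statement (UNTWISTING, the lever's descent half): for `t > 0`, if the `L`-Weil classes of
`A ⊗ O_F = (A × A, φ × φ, ψ_F)` are algebraic then the `K`-Weil classes of the sixfold `A` are. -/
def Untwisting : Prop :=
  ∀ (A : AbelianVariety ℂ) (φ : A ⟶ A), A.dim = 6 → φ ≫ φ = -((7 : ℤ) • 𝟙 A) →
    ∀ t : ℕ, 0 < t → LWeilAlgebraic (bc A) (psiK A φ) (psiF A t) t → KWeilAlgebraic A φ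

/-- STUB 2 statement (BASE-CHANGE SPLITTING, the lever's aiming half): a sixfold `(A, φ)` carrying a
NON-ZERO rational `(3,3)` class in its Weil plane (the Weil-type witness) has, for some real quadratic
`F = ℚ(√t)` and the `L`-symmetrised hyperplane polarization of some projective embedding of `A × A`,
a base change `A ⊗ O_F` of SPLIT `L`-Weil type. -/
def BaseChangeSplitting : Prop :=
  ∀ (A : AbelianVariety ℂ) (φ : A ⟶ A), A.dim = 6 → φ ≫ φ = -((7 : ℤ) • 𝟙 A) →
    (∃ c : complexBetti A.X 6, IsRationalClass c ∧ IsOfHodgeType 6 A.X 6 3 3 c ∧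
      c ∈ KWeilSpan A φ ∧ c ≠ 0) →
    ∃ (t : ℕ) (e : ProjectiveEmbedding (bc A).X) (a : complexBetti (projectiveSpace e.n ℂ) 2),
      0 < t ∧ ¬ IsSquare t ∧ IsRationalClass a ∧ a ≠ 0 ∧ SplitFrame (bc A) (psiK A φ) (psiF A t) t e a

/-- STUB 3 statement (SPLIT SECANT CLASS — the transferred crux `C⁺(F)`, HARDEST): on every polarized
abelian 12-fold `(B, ψ_K, ψ_F, h)` with commuting `ψ_K² = -7`, `ψ_F² = t` (`t > 0` non-square, `h` an
`L`-symmetrised hyperplane class) of SPLIT `L`-Weil type, ONE non-zero rational `L`-Weil class is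
algebraic. -/
def SplitSecantClass : Prop :=
  ∀ (B : AbelianVariety ℂ) (ψK ψF : B ⟶ B) (t : ℕ), B.dim = 12 → ψK ≫ ψK = -((7 : ℤ) • 𝟙 B) →
    ψF ≫ ψF = (t : ℤ) • 𝟙 B → ψK ≫ ψF = ψF ≫ ψK → 0 < t → ¬ IsSquare t →
    ∀ (e : ProjectiveEmbedding B.X) (a : complexBetti (projectiveSpace e.n ℂ) 2),
      IsRationalClass a → a ≠ 0 → SplitFrame B ψK ψF t e a → OneLWeilClassAlgebraic B ψK ψF t

/-- STUB 4 statement (ONE CLASS SUFFICES): on a 12-fold with commuting `ψ_K² = -7`, `ψ_F² = t` (`t > 0`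
non-square), one non-zero rational algebraic `L`-Weil class makes every rational `(3,3)` `L`-Weil class
algebraic. -/
def OneClassSuffices : Prop :=
  ∀ (B : AbelianVariety ℂ) (ψK ψF : B ⟶ B) (t : ℕ), B.dim = 12 → ψK ≫ ψK = -((7 : ℤ) • 𝟙 B) →
    ψF ≫ ψF = (t : ℤ) • 𝟙 B → ψK ≫ ψF = ψF ≫ ψK → 0 < t → ¬ IsSquare t →
    OneLWeilClassAlgebraic B ψK ψF t → LWeilAlgebraic B ψK ψF t

/-! ### The registered stubs -/

/-- STUB 1 (L; provable once Künneth / `H^* = ∧^* H¹` reach the carriers — the same infrastructure gap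
as the route's `WeilDescending`) — UNTWISTING `ι^* : W_L(A × A) ↠ W_K(A)`. Why true: (i) by
`H^*(A) = ∧^* H¹` and `(1+i√7)/(1-i√7)` of norm 1 and not a root of unity (not even an algebraic
integer), `KWeilSpan A φ = ∧⁶V_σ ⊕ ∧⁶V_σ̄` (`V_σ`, `V_σ̄` the `±i√7`-eigenspaces of `φ^*` on `H¹`, each
of dimension 6), of Hodge types `(a, 6-a)`, `(6-a, a)`, `a = dim V_σ^{1,0}`; a rational `(3,3)` class
`c ≠ 0` in it forces `a = 3` (directness of the Hodge decomposition), and `c = 0` is algebraic — so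
assume Weil type `(3,3)`. (ii) On `A × A`, `ψ_F^*` has matrix `(0 1; t 0)` on `(p₁^*α, p₂^*α)`
(`psiF ≫ fst = t·snd`, `psiF ≫ snd = fst`), eigenvectors `p₁^*α ± √t p₂^*α` (`±√t`), so
`V_{(σ,±)} = {p₁^*α ± √t·p₂^*α : α ∈ V_σ}` and `lWeilSpan = ⊕ ∧⁶ V_{(σ,±)}` — four LINES, because
`(1+√t)^p (1-√t)^{6-p} = (1+√t)⁶` forces `p = 6` (`|1-√t| < 1+√t` for `t > 0`) and the `K`-characters
separate as in (i) (triage r1 (d)); all four lines are `(3,3)`, hence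
`W_L := lWeilSpan ∩ H⁶(A×A, ℚ)` (`dim_ℚ 4`) consists of rational `(3,3)` classes, ALL algebraic by the
hypothesis `LWeilAlgebraic`. (iii) `∧⁶{p₁^*αᵢ ± √t p₂^*αᵢ} = Σ_k (±√t)^k Ω_σ^{(6-k,k)}` with
`Ω^{(6-k,k)} ∈ p₁^*∧^{6-k}V_σ ⌣ p₂^*∧^k V_σ`; for `ι = prodLift (𝟙 A) 0`, `ι^* p₂^* = 0^* = 0` on `H^{≥1}`
and `ι^* p₁^* = id`, so `ι^*(line_{(σ,±)}) = ∧⁶V_σ`: `ι^* : W_L ⊗ ℂ → W_K ⊗ ℂ` is onto, hence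
`ι^*(W_L) = W_K` over `ℚ` (`ι^*` maps rational to rational) and `c = ι^* c̃` with `c̃ ∈ W_L` algebraic.
(iv) `ι^*` preserves algebraic classes (Fulton Ch. 8: `ι^* cl(Z) = cl(ι^![Z])` for `ι` into a smooth
variety; in tree today for flat maps only, `map_mem_algebraicClasses_of_flat`, so ALTERNATIVELY write
`ι^* c̃ = pr_{1*}(c̃ ⌣ pr₂^* cl(pt))` and use a `GysinFormalism` with `AlgebraicClassesCup` — the route
`WeilClassesFourfoldsProofs.mem_algebraicClasses_of_gysin_fst_cupProduct` is this exact transfer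
pattern). Uses the hypotheses `IsRationalClass` (to land in `W_K`, not just `W_K ⊗ ℂ`) and
`IsOfHodgeType (3,3)` (case split). Leans on: `WeilClassesProducts`
(`cupProduct_mem_pullbackEigenclasses`, `mem_and_mem_of_smul_add_smul_mem`), `WeilClasses`
(`eq_zero_of_forall_natCast_add_pow_eq`), `WeilClassesFourfoldsProofs` (`nsmul_id_add_nsmul_comp_fst`,
Gysin transfer), `AbelianVarietyProduct` (`prodLift_fst/_snd`, `prod_hom_ext`),
`linearIndependent_iff_of_isRationalClass`, Markman 2509.23079 §1.1 (`HW = ∧^d_K H¹`), Moonen–Zarhin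
(Duke 77) §2, van Geemen LNM 1594 4.9 / Thm 6.12. -/
theorem stub_untwisting :
    ∀ (A : AbelianVariety ℂ) (φ : A ⟶ A), A.dim = 6 → φ ≫ φ = -((7 : ℤ) • 𝟙 A) →
      ∀ t : ℕ, 0 < t → LWeilAlgebraic (bc A) (psiK A φ) (psiF A t) t → KWeilAlgebraic A φ := by
  sorry

/-- STUB 2 (L; classical: Landherr 1936 / Deligne–Milne / Markman 2509.23079 Lemma 8.3.4 (2), plus the
carrier dictionary of `Motives/HyperbolicWeilType` (1)–(4)) — BASE-CHANGE SPLITTING. Why true: the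
witness `c ≠ 0` forces `K`-Weil type `(3,3)` (STUB 1 (i)). Take the Segre-type embedding `e` of `A × A`
built from a projective embedding `ι_A` of the abelian variety `A` (Mumford §6; `Motives/SegreEmbedding`,
`Motives/AbelianVarietyProjective`) and `a = [H]`: then `e.ι^* a = fst^*h₀ + snd^*h₀`, `h₀ = ι_A^*[H]`
ample, and (using `psiF ≫ fst = t·snd`, `psiF ≫ snd = fst`, `[t]^* = t²` on `H²`)
`(t + ψ_F^*)(fst^*h₀ + snd^*h₀) = (1+t)(fst^*h₀ + t·snd^*h₀)`, so the `L`-symmetrised class is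
`h = (1+t)·[E_A ⊕ tE_A]`, `E_A = 7E₀ + φ^*E₀` the ample `K`-compatible polarization of van Geemen
5.2 (1) (`φ` is an isogeny). Its hermitian form `H_A` on the 6-dimensional `K`-space `H₁(A, ℚ)` has
signature `(3,3)` (5.2 (6)) and `det H_A = -δ₀`, `δ₀ ∈ ℚ_{>0}`. CHOOSE `t`: the positive non-square
integer with `ℚ(√t) = ℚ(√δ₀)` if `δ₀ ∉ (ℚ^×)²`, else any positive non-square `t` (then `(δ₀,-7)_ℚ` is
already split — this is Markman's known class `disc = -1`); in both cases `F = ℚ(√t)` splits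
`D = (δ₀, -7)_ℚ`, i.e. `δ₀ ∈ Nm_{L/F}(L^×)`, `L = F(√-7)` a CM field of degree 4 (`√t ∉ K`). The
relative hermitian form of `(A ⊗ O_F, η_L, E_A ⊕ tE_A)` is `H_A ⊗_K L` (`E_A ⊕ tE_A = E_A ⊗ Tr_{F/ℚ}`
in the basis `1, √t`): signatures `(3,3),(3,3)`, discriminant `-δ₀ ≡ (-1)³ mod Nm_{L/F} L^×`; by
Lemma 8.3.4 (2) there is an `H_L`-isotropic `L`-subspace `W ⊆ H₁(A×A, ℚ)` of `L`-dimension 3;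
`H_L|_W = 0 ⟺ E|_W = 0` on `L`-subspaces (`forall_weilHermitianForm_eq_zero_iff` pattern), and
`Ann(W) ⊆ H¹(A×A, ℚ)` is an `L`-stable (`ψ_K^*`, `ψ_F^*`-stable) `Q_h`-Lagrangian rational subspace of
dimension 12 (`Q_h = c·E^*·vol`, `c ≠ 0` as `E_h` is non-degenerate; `H^* = ∧^*H¹`, Birkenhake–Lange
1.1.17/1.7.4); a `ℚ`-basis gives the frame (`linearIndependent_iff_of_isRationalClass`). The
positive scalar `(1+t)` changes nothing (`polarizationPairingOne_smul`). Why it might need reshaping: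
only bookkeeping (which embedding; the lead may prefer to quantify the frame over an abstract
non-degenerate `L`-compatible `(1,1)` class) — the mathematics is the Hilbert-symbol computation
`(δ₀, -7)_F = 0`, re-done by hand in the card (falsifier (1)) and by the triager (check (c)). -/
theorem stub_baseChangeSplitting :
    ∀ (A : AbelianVariety ℂ) (φ : A ⟶ A), A.dim = 6 → φ ≫ φ = -((7 : ℤ) • 𝟙 A) →
      (∃ c : complexBetti A.X 6, IsRationalClass c ∧ IsOfHodgeType 6 A.X 6 3 3 c ∧
        c ∈ KWeilSpan A φ ∧ c ≠ 0) →
      ∃ (t : ℕ) (e : ProjectiveEmbedding (bc A).X) (a : complexBetti (projectiveSpace e.n ℂ) 2),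
        0 < t ∧ ¬ IsSquare t ∧ IsRationalClass a ∧ a ≠ 0 ∧
          SplitFrame (bc A) (psiK A φ) (psiF A t) t e a := by
  sorry

/-- STUB 3 (XL, OPEN — the line's target `C⁺(F)` = Markman's relative secant programme at
`(d, e, n) = (6, 4, 6)`; HARDEST) — SPLIT SECANT CLASS. Why plausibly true / the work:
(0) `a ≠ 0` rational means `a = q[H]`, `q ∈ ℚ^×`, so `h` is `±` an ample `L`-compatible polarization
class and `SplitFrame` says `(B, η_L, ±E_h)` is a POLARIZED abelian 12-fold of SPLIT `L`-Weil type
(2509.23079 Def 8.3.5); balanced signatures + positivity give `L`-Weil type `(3,3)` at all four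
embeddings (Deligne–Milne), so `W_L = lWeilSpan ∩ H⁶(B, ℚ) = HW(B, η)` is 4-dimensional and Hodge.
(1) MEMBERSHIP (Lemma 10.2.3 + Remark 10.2.1 for the CM-type label): `(B, η, E_h) ≅ ((X_F × X̂_F, I),
η, Ξ_{t'})` for some `I ∈ Ω_{B,t'}`, `t' ∈ L_-`, and ANY split anchor `(X_F × X̂_F, η_{Θ,q=7}, Ξ)` with
`X_F` an abelian SIXFOLD with real multiplication by `F = ℚ(√t)` (Lemma 12.1.2: `I_{X×X̂} ∈ Ω_{B,t}` and `(X×X̂, η, Ξ_t)` is of split type;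
candidates `X_F = B_F³` for an RM surface `B_F`, a genus-6 RM Jacobian with a norm-one unit acting
(the §12.2 device), or `X_F = X ⊗ O_F` for Markman's genus-3 Jacobian `X`). (2) SECANT PAIR at `(6,4)`
(UNBUILT in print — Example 12.x is `(d,e) = (4,4)`): `B`-secant sheaves `F₁, F₂` on `X_F` (Chern
characters in the rational 4-dimensional secant space `B ⊆ H^{ev}(X_F, ℚ)`) with
`rank Φ(F₁ ⊠ F₂^∨) ≠ 0` and the `BB₁`-genericity of Prop 1.1.1; then (Thm 1.1.2) the flat deformation
of `κ(E)`, `E = Φ(F₁ ⊠ F₂^∨)`, stays Hodge on `(B, η)` and `κ₃(E)` projects to a NON-ZERO class of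
`HW(B, η)`. (3) SEMIREGULARITY at `e = 4` (OPEN — "postponed", 2509.23079 §1.1 last paragraph; the
genus-3 argument of 2502.03415 §1.5 is "special to genus 3"; 2509.23403 p. 18: the non-equivariant
`𝓔` fails for `q ≥ 4` as `dim Ext²` grows): an equivariantly semiregular choice (Buchweitz–Flenner
Thm 5.1 / Pridham / Markman's twisted semiregularity theorem) makes `κ(E)` stay ALGEBRAIC over an
analytic neighbourhood of the anchor in the Hodge locus of `κ`, which is all of `Ω_{B,t'}` (complete
family, Rem 10.2.4); (4) SPREADING: algebraic on an open subset of the irreducible `Ω_{B,t'}` ⇒ on all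
of it (CDK algebraicity of the Hodge locus + countability, as in 2502.03415 §1.5) ⇒ at `I`, i.e. on
`B`: the `HW`-projection of `κ₃` is a non-zero rational ALGEBRAIC class of `W_L(B)` (its complement in
`𝒜⁶ = Im Sym³(𝒜²) ⊕ HW` being a polynomial in algebraic divisor classes). Barriers: evades
`Weil1977_exceptionalHodgeClasses` / `Mumford1968_simpleFourfold_exceptionalHodgeClasses` (the cycle is
`ch` of an Orlov image of a box product of secant sheaves, `K`-charge `±6`, not a divisor polynomial);
uses `CattaniDeligneKaplan1995_hodgeLocus_algebraicFor` positively; `Voisin2002_weilTorus…Narrow` does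
not bite (`κ₂ ≠ 0` pairs with the Kähler class); `Andre1996…motivated` /
`hodgeClassesAreAbsoluteFor…` are refutation-side only. If no equivariantly semiregular pair exists on
any RM sixfold tried, the line stalls exactly where Markman's does (card falsifier (3)). -/
theorem stub_splitSecantClass :
    ∀ (B : AbelianVariety ℂ) (ψK ψF : B ⟶ B) (t : ℕ), B.dim = 12 → ψK ≫ ψK = -((7 : ℤ) • 𝟙 B) →
      ψF ≫ ψF = (t : ℤ) • 𝟙 B → ψK ≫ ψF = ψF ≫ ψK → 0 < t → ¬ IsSquare t →
      ∀ (e : ProjectiveEmbedding B.X) (a : complexBetti (projectiveSpace e.n ℂ) 2),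
        IsRationalClass a → a ≠ 0 → SplitFrame B ψK ψF t e a → OneLWeilClassAlgebraic B ψK ψF t := by
  sorry

/-- STUB 4 (M/L; Lieberman-type, mostly in-tree tools) — ONE CLASS SUFFICES ("it suffices to prove the
algebraicity of one non-zero class in `HW(A, η)`, as `K` acts via algebraic correspondences",
2509.23079 p. 2). Why true: `L := ℚ[ψ_K, ψ_F] ≅ ℚ(√-7, √t)` is a FIELD (`t > 0` non-square, so
`√t ∉ ℚ(√-7)`), `H¹(B, ℚ)` is a free `L`-module of rank `24/4 = 6`, and
`W_L := lWeilSpan ∩ H⁶(B, ℚ) = ∧⁶_L H¹(B, ℚ)` is an `L`-LINE containing `c₀ ≠ 0`, so `W_L = L · c₀`,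
where `l ∈ L` acts on `∧⁶_L H¹` through `l⁶` under pull-back by the endomorphism `l`; every non-zero
`l ∈ ℤ[ψ_K, ψ_F]` is an ISOGENY, hence finite flat, so `l^*` preserves `algebraicClasses`
(`map_mem_algebraicClasses_of_flat`, in tree) and rational classes, and the `ℚ`-span of sixth powers
of `ℤ[ψ_K, ψ_F]` is `L` (Vandermonde on `(m + l)⁶`, `m = 0..6`); so every class of `W_L` — in
particular every rational `(3,3)` class of `lWeilSpan` — is a `ℚ`-combination of the algebraic
`l^* c₀`. (No Hodge theory needed: the stub proves slightly more than `LWeilAlgebraic`.) Leans on: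
`map_mem_algebraicClasses_of_flat` (`HodgeConjectureQbarVoisinProofs`),
`WeilClasses.map_mem_pullbackEigenclasses` pattern (pull-backs commuting with `ψ_K, ψ_F` preserve the
joint eigenspaces), `IsRationalClass.map/.smul/.add`, `linearIndependent_iff_of_isRationalClass`;
`Motives.standardConjectureB_abelianVariety` (Lieberman) only if one prefers correspondences to
isogenies. -/
theorem stub_oneClassSuffices :
    ∀ (B : AbelianVariety ℂ) (ψK ψF : B ⟶ B) (t : ℕ), B.dim = 12 → ψK ≫ ψK = -((7 : ℤ) • 𝟙 B) →
      ψF ≫ ψF = (t : ℤ) • 𝟙 B → ψK ≫ ψF = ψF ≫ ψK → 0 < t → ¬ IsSquare t →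
      OneLWeilClassAlgebraic B ψK ψF t → LWeilAlgebraic B ψK ψF t := by
  sorry

/-! ### Consistency: each named statement IS its registered stub (definitionally) -/

theorem untwisting_holds : Untwisting := stub_untwisting
theorem baseChangeSplitting_holds : BaseChangeSplitting := stub_baseChangeSplitting
theorem splitSecantClass_holds : SplitSecantClass := stub_splitSecantClass
theorem oneClassSuffices_holds : OneClassSuffices := stub_oneClassSuffices

/-! ### Name-keyed aliases of the four statements (the hypotheses of the composition) -/
namespace Registered

/-- Alias of `Untwisting` keyed by the registered stub name. -/
abbrev stub_untwisting : Prop := Untwisting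
/-- Alias of `BaseChangeSplitting` keyed by the registered stub name. -/
abbrev stub_baseChangeSplitting : Prop := BaseChangeSplitting
/-- Alias of `SplitSecantClass` keyed by the registered stub name. -/
abbrev stub_splitSecantClass : Prop := SplitSecantClass
/-- Alias of `OneClassSuffices` keyed by the registered stub name. -/
abbrev stub_oneClassSuffices : Prop := OneClassSuffices

end Registered

/-! ### The composition: the four stubs imply the crux, by name -/

/-- `WeilSixfoldsSqrtMinus7` from the four stubs (pure logic plus the PROVED product bookkeeping; no
`sorry`). Given `(A, φ)` and a rational `(3,3)` class `c` of the Weil plane: if `c = 0` it is algebraic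
(`0 ∈ N³H⁶`). Otherwise `c` witnesses Weil type, STUB 2 gives `(t, e, a)` with the base change
`A ⊗ O_{ℚ(√t)}` of split `L`-Weil type, STUB 3 (fed with `dim_bc`, `psiK_comp_psiK`, `psiF_comp_psiF`,
`psiK_comm_psiF`) one non-zero rational algebraic `L`-Weil class on it, STUB 4 all of them, and STUB 1
descends to the `K`-Weil classes of `A`, in particular `c`. -/
theorem WeilSixfoldsSqrtMinus7_of (h1 : Registered.stub_untwisting)
    (h2 : Registered.stub_baseChangeSplitting) (h3 : Registered.stub_splitSecantClass)
    (h4 : Registered.stub_oneClassSuffices) :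
    Summit.HodgeConjecture.HodgeConjecture.Theses.HeckePrymWeil.WeilSixfoldsSqrtMinus7 := by
  intro A φ hdim hφ c hrat hhodge hmem
  by_cases hc : c = 0
  · rw [hc]
    exact Submodule.zero_mem _
  · obtain ⟨t, e, a, ht, hsq, ha, ha0, hsplit⟩ := h2 A φ hdim hφ ⟨c, hrat, hhodge, hmem, hc⟩
    have hone : OneLWeilClassAlgebraic (bc A) (psiK A φ) (psiF A t) t :=
      h3 (bc A) (psiK A φ) (psiF A t) t (dim_bc hdim) (psiK_comp_psiK hφ) (psiF_comp_psiF A t)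
        (psiK_comm_psiF A φ t) ht hsq e a ha ha0 hsplit
    have hL : LWeilAlgebraic (bc A) (psiK A φ) (psiF A t) t :=
      h4 (bc A) (psiK A φ) (psiF A t) t (dim_bc hdim) (psiK_comp_psiK hφ) (psiF_comp_psiF A t)
        (psiK_comm_psiF A φ t) ht hsq hone
    exact h1 A φ hdim hφ t ht hL c hrat hhodge hmem

/-- Wiring check: the registered stubs feed `WeilSixfoldsSqrtMinus7_of` as stated. -/
example : Summit.HodgeConjecture.HodgeConjecture.Theses.HeckePrymWeil.WeilSixfoldsSqrtMinus7 :=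
  WeilSixfoldsSqrtMinus7_of stub_untwisting stub_baseChangeSplitting stub_splitSecantClass
    stub_oneClassSuffices

/-! ### Sanity: the crux body for fixed `(A, φ)` IS `KWeilAlgebraic A φ` (so STUB 1 is no costume of the
crux: it trades the `K`-Weil classes of a SIXFOLD for the `L`-Weil classes of its 12-fold base change) -/
example : Summit.HodgeConjecture.HodgeConjecture.Theses.HeckePrymWeil.WeilSixfoldsSqrtMinus7 ↔
    ∀ (A : AbelianVariety ℂ) (φ : A ⟶ A), A.dim = 6 → φ ≫ φ = -((7 : ℤ) • 𝟙 A) →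
      KWeilAlgebraic A φ :=
  Iff.rfl

end Summit.HodgeConjecture.HodgeConjecture.Cruxes.WeilSixfoldsSqrtMinus7.RealQuadraticBaseChange

end
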